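import Mathlib
import Literature.NumberTheory.Transcendental.GammaFields
import Literature.NumberTheory.Transcendental.GammaIsoAlgebraicStep
import Literature.NumberTheory.Transcendental.ZilberField
import Literature.NumberTheory.Transcendental.ZilberFieldExistenceProofs
import Summits.Schanuel.Schanuel.Theorems.RigidCoreAclSubsetLogFreeCoreCaseIIReduceChains
import Summits.Schanuel.Schanuel.Theorems.RigidCoreAclSubsetLogFreeCoreCaseIIReduceField
import Summits.Schanuel.Schanuel.Theorems.RigidCoreAclSubsetLogFreeCoreCaseIIShift
import Summits.Schanuel.Schanuel.Theorems.RigidCoreAclSubsetLogFreeCoreCaseIIReduceMinimal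

/-!
# Case II reduction, file 4: assembly modulo the branch-shifting automorphism
(registered stub `caseII_reduce_of_shiftAut` of line `eac-extends-core-automorphisms`,
crux stmt-Schanuel-0968 `Summit.Schanuel.Schanuel.Theses.RigidCore.AclSubsetLogFreeCore`)

In a Zilber field `E` with kernel `τℤ`, granted
* `hshift`: for a strong `X = ℚτ + ℚ(range c)` and an L-step `ℓ` over `X` (`exp ℓ` algebraic over the
  Γ-field `ℚ(gens X)`, `ℓ` not) an exponential field automorphism `θ` fixing `c`, `τ` with
  `θ ℓ = ℓ + mτ`, `m ≥ 1` (the neighbouring stub `stub_caseII_shiftAut`), and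
* `hcore`: the core claim (the neighbouring stub `stub_caseII_core`): in an A-extension `U` of
  `X + ℚℓ` in which `X` is A-closed, every `θ`-fixed element lies in `X`,
every element `a` of the ELA-core over `τ` fixed by all exponential automorphisms lies in the EA-core.

Proof (`caseII_reduce_of_shiftAut`): `Λ₀ = ℚτ ◁ E` (Schanuel property); `a` lies in a strong
`δ = 0` E/L/A-chain space `W` over `Λ₀` (`CaseIIReduce.exists_chain_of_mem_sInf`,
`chain_isStrong_and_predim_eq_zero`); the `δ = 0` subspace `Λ₀ ≤ H ≤ W` containing `a` of least
`ldim(H/Λ₀)` is unique below itself (`δ = 0` subspaces are closed under `⊓`) and `θ`-stable for every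
exponential automorphism fixing `τ` and `a` (`CaseIIReduce.forall_mem_iff_of_minimal`). Descent on
`ldim(H/X)` over the strong A-closed proper subspaces `X = ℚτ + ℚ(range c)` of `H`: such an `X`
admits an L-step `ℓ ∈ H` (`exists_Lstep_of_Aclosed`); the A-closure `P` of `X + ℚℓ` in `H` is a strict
A-extension (`exists_maximal_Achain`); if `P = H`, `hshift` and `hcore` give `a ∈ X`, so `X = H` by
minimality — absurd; else recurse with `P`. Applied to the A-closure `P₀` of `Λ₀` in `H` this shows
`P₀ = H`, an A-extension of `Λ₀`, which lies in every `exp`-closed relatively algebraically closed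
intermediate field containing `τ` (`sup_span_range_le_of_Achain`).
-/

noncomputable section

set_option linter.dupNamespace false

open Set
open Literature.ModelTheory.ExponentialFields Literature.ModelTheory.ExponentialFields.ExponentialRing
open Literature.NumberTheory.Transcendental Literature.NumberTheory.Transcendental.GammaField

namespace Summit.Schanuel.Schanuel.Theorems.RigidCore

set_option linter.unusedVariables false in
/-- **Case II, reduction to the core claim modulo the branch shift** (registered stub
`caseII_reduce_of_shiftAut` of crux stmt-Schanuel-0968). In a Zilber field `E` with kernel `τℤ`,
granted the branch-shifting automorphisms `hshift` of L-steps over strong `ℚτ + ℚ(range c)` and the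
core claim `hcore`, every element of the ELA-core over `τ` (the least intermediate field `∋ τ` closed
under `exp`, under logarithms and relatively algebraically closed) which is fixed by every
exponential field automorphism of `E` lies in the EA-core (the same without logarithms): the minimal
`δ = 0` hull of `a` over `ℚτ` inside an E/L/A-chain space is an A-extension of `ℚτ`, because a first
L-step in it would be shifted by an automorphism fixing `a` and the hull. (The hypothesis
`huniv : ecl ∅ = univ` of the registered signature is not needed here: it is consumed by the
neighbouring stub `stub_caseII_shiftAut`, which supplies `hshift` in the assembled `stub_caseII_reduce`.)
[cite: BaysKirby2018ANT, Lemma 4.8, §4.4] -/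
theorem caseII_reduce_of_shiftAut {E : Type} [Field E] [CharZero E] [ExponentialRing E]
    (hE : IsZilberField E) (huniv : ecl (∅ : Set E) = Set.univ)
    (τ : E) (hker : expKernel E = AddSubgroup.zmultiples τ)
    (hshift : ∀ {N : ℕ} (c : Fin N → E),
      IsStrong (Submodule.span ℚ ({τ} : Set E) ⊔ Submodule.span ℚ (range c)) →
      ∀ {ℓ : E}, exp ℓ ∈ acl (gens (Submodule.span ℚ ({τ} : Set E) ⊔ Submodule.span ℚ (range c))) →
        ℓ ∉ acl (gens (Submodule.span ℚ ({τ} : Set E) ⊔ Submodule.span ℚ (range c))) →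
        ∃ (θ : E ≃+* E) (m : ℕ), 0 < m ∧ (∀ x, θ (exp x) = exp (θ x)) ∧ (∀ j, θ (c j) = c j) ∧
          θ τ = τ ∧ θ ℓ = ℓ + (m : ℚ) • τ)
    (hcore : ∀ (X : Submodule ℚ E), τ ∈ X → X.FG → IsStrong X →
      ∀ (ℓ : E), exp ℓ ∈ acl (gens X) → ℓ ∉ acl (gens X) →
      ∀ (U : Submodule ℚ E) (s : ℕ) (v : Fin s → E),
        U = (X ⊔ Submodule.span ℚ {ℓ}) ⊔ Submodule.span ℚ (range v) →
        (∀ i : Fin s,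
          v i ∉ (X ⊔ Submodule.span ℚ {ℓ}) ⊔ Submodule.span ℚ (v '' Set.Iio i) ∧
          v i ∈ acl (gens ((X ⊔ Submodule.span ℚ {ℓ}) ⊔ Submodule.span ℚ (v '' Set.Iio i)))) →
        (∀ u ∈ U, u ∈ acl (gens X) → u ∈ X) →
        ∀ (θ : E ≃+* E), (∀ x, θ (exp x) = exp (θ x)) → (∀ x ∈ X, θ x = x) →
          ∀ (q : ℚ), q ≠ 0 → θ ℓ = ℓ + q • τ → (∀ u, u ∈ U ↔ θ u ∈ U) →
            ∀ a ∈ U, θ a = a → a ∈ X) :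
    ∀ a : E,
      a ∈ (sInf {K : IntermediateField ℚ E | τ ∈ K ∧ (∀ w ∈ K, exp w ∈ K) ∧
          (∀ w : E, IsAlgebraic K w → w ∈ K) ∧ (∀ w : E, exp w ∈ K → w ∈ K)} :
            IntermediateField ℚ E) →
      (∀ θ : E ≃+* E, (∀ x, θ (exp x) = exp (θ x)) → θ a = a) →
        a ∈ (sInf {K : IntermediateField ℚ E | τ ∈ K ∧ (∀ w ∈ K, exp w ∈ K) ∧
          (∀ w : E, IsAlgebraic K w → w ∈ K)} : IntermediateField ℚ E) := by
  classical
  intro a ha hfix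
  /- (1) `Λ₀ = ℚτ` is strong: `τ` is a transcendental kernel generator and `E` has the Schanuel
  property -/
  have hexpτ : exp τ = 1 := by
    rw [← mem_expKernel_iff, hker]; exact AddSubgroup.mem_zmultiples τ
  have htrans : Transcendental ℚ τ := by
    obtain ⟨τ₀, hτ₀, hker₀⟩ := hE.hasStandardKernel
    have hmem : τ₀ ∈ expKernel E := by rw [hker₀]; exact AddSubgroup.mem_zmultiples τ₀
    rw [hker, AddSubgroup.mem_zmultiples_iff] at hmem
    obtain ⟨m, hm⟩ := hmem
    intro halg
    apply hτ₀
    rw [← hm, zsmul_eq_mul]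
    exact (isAlgebraic_int m).mul halg
  have hΛ₀ : IsStrong (Submodule.span ℚ ({τ} : Set E)) :=
    (schanuelProperty_iff_isStrong_span_kernelGenerator htrans hexpτ).1 hE.schanuelProperty
  /- (2) `a` lies in a `δ = 0` E/L/A-chain space `W` over `Λ₀` -/
  obtain ⟨n, u, hu, haW⟩ := CaseIIReduce.exists_chain_of_mem_sInf ha
  obtain ⟨-, hδW⟩ := CaseIIReduce.chain_isStrong_and_predim_eq_zero hΛ₀ u hu
  have hfgW : IsFG (Submodule.span ℚ ({τ} : Set E))
      (Submodule.span ℚ ({τ} : Set E) ⊔ Submodule.span ℚ (range u)) :=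
    isFG_sup_left.2 (isFG_span_of_finite _ (finite_range u))
  /- (3) the minimal `δ = 0` hull `H` of `a` over `Λ₀` inside `W`: least `ldim(H/Λ₀)` -/
  have hex : ∃ d, ∃ K : Submodule ℚ E, (Submodule.span ℚ ({τ} : Set E) ≤ K ∧
      K ≤ Submodule.span ℚ ({τ} : Set E) ⊔ Submodule.span ℚ (range u) ∧ a ∈ K ∧
      predim (Submodule.span ℚ ({τ} : Set E)) K = 0) ∧
      ldim (Submodule.span ℚ ({τ} : Set E)) K = d :=
    ⟨_, _, ⟨le_sup_left, le_rfl, haW, hδW⟩, rfl⟩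
  obtain ⟨H, ⟨hΛ₀H, hHW, haH, hδH⟩, hHd⟩ := Nat.find_spec hex
  have hHmin : ∀ K : Submodule ℚ E, Submodule.span ℚ ({τ} : Set E) ≤ K →
      K ≤ Submodule.span ℚ ({τ} : Set E) ⊔ Submodule.span ℚ (range u) → a ∈ K →
      predim (Submodule.span ℚ ({τ} : Set E)) K = 0 →
      ldim (Submodule.span ℚ ({τ} : Set E)) H ≤ ldim (Submodule.span ℚ ({τ} : Set E)) K :=
    fun K h1 h2 h3 h4 => by rw [hHd]; exact Nat.find_min' hex ⟨K, ⟨h1, h2, h3, h4⟩, rfl⟩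
  have hfgH : IsFG (Submodule.span ℚ ({τ} : Set E)) H := hfgW.mono hHW
  have MIN : ∀ K : Submodule ℚ E, Submodule.span ℚ ({τ} : Set E) ≤ K → K ≤ H → a ∈ K →
      predim (Submodule.span ℚ ({τ} : Set E)) K = 0 → H ≤ K := by
    intro K h1 h2 h3 h4
    have hle := hHmin K h1 (h2.trans hHW) h3 h4
    have hadd := ldim_add h1 h2 hfgH
    exact (ldim_eq_zero_iff (hfgH.of_le_left h1)).1 (by omega)
  -- `H` is `θ`-stable for every exponential automorphism fixing `τ` and `a`
  have STAB : ∀ θ : E ≃+* E, (∀ x, θ (exp x) = exp (θ x)) → θ τ = τ → θ a = a →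
      ∀ u, u ∈ H ↔ θ u ∈ H := fun θ hθ hθτ hθa =>
    CaseIIReduce.forall_mem_iff_of_minimal hΛ₀ hΛ₀H hfgH hδH haH MIN θ hθ hθτ hθa
  /- (4) no strong proper subspace `X = ℚτ + ℚ(range c)` of `H` is A-closed in `H`:
  descent on `ldim(H/X)` -/
  have key : ∀ (d : ℕ) (X : Submodule ℚ E) (N : ℕ) (c : Fin N → E),
      X = Submodule.span ℚ ({τ} : Set E) ⊔ Submodule.span ℚ (range c) → X ≤ H → X ≠ H →
      IsStrong X → (∀ h ∈ H, h ∈ acl (gens X) → h ∈ X) → ldim X H ≤ d → False := by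
    intro d
    induction d with
    | zero =>
      intro X N c hX hXH hne _ _ hd
      have hΛ₀X : Submodule.span ℚ ({τ} : Set E) ≤ X := by rw [hX]; exact le_sup_left
      exact hne (le_antisymm hXH ((ldim_eq_zero_iff (hfgH.of_le_left hΛ₀X)).1 (Nat.le_zero.1 hd)))
    | succ d ih =>
      intro X N c hX hXH hne hXs hA hd
      have hΛ₀X : Submodule.span ℚ ({τ} : Set E) ≤ X := by rw [hX]; exact le_sup_left
      have hfgXH : IsFG X H := hfgH.of_le_left hΛ₀X
      -- an L-step `ℓ ∈ H` over `X`, the strong base `V = X + ℚℓ ≤ H`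
      obtain ⟨ℓ, hℓH, hℓX, hℓexp, hℓ⟩ :=
        CaseIIReduce.exists_Lstep_of_Aclosed hΛ₀ u hu hΛ₀H hHW hδH hΛ₀X hXH hne hA
      have hVs : IsStrong (X ⊔ Submodule.span ℚ {ℓ}) :=
        CaseIIReduce.isStrong_sup_span_of_Lstep hXs hℓexp hℓ
      have hVH : X ⊔ Submodule.span ℚ {ℓ} ≤ H :=
        sup_le hXH ((Submodule.span_singleton_le_iff_mem _ _).2 hℓH)
      have hfgVH : IsFG (X ⊔ Submodule.span ℚ {ℓ}) H := hfgXH.of_le_left le_sup_left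
      -- the A-closure `P` of `V` in `H`, a strict A-extension of `V`
      obtain ⟨r, v, hvH, hv, hPA⟩ := CaseIIReduce.exists_maximal_Achain hVH hfgVH
      have hPH : (X ⊔ Submodule.span ℚ {ℓ}) ⊔ Submodule.span ℚ (range v) ≤ H :=
        sup_le hVH (Submodule.span_le.2 (range_subset_iff.2 hvH))
      have hℓP : ℓ ∈ (X ⊔ Submodule.span ℚ {ℓ}) ⊔ Submodule.span ℚ (range v) :=
        Submodule.mem_sup_left (Submodule.mem_sup_right (Submodule.mem_span_singleton_self ℓ))
      by_cases hPeq : (X ⊔ Submodule.span ℚ {ℓ}) ⊔ Submodule.span ℚ (range v) = H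
      · -- `P = H`: the branch shift `θ` and the core claim put `a` in `X`; minimality gives `X = H`
        have hXs' : IsStrong (Submodule.span ℚ ({τ} : Set E) ⊔ Submodule.span ℚ (range c)) := by
          rw [← hX]; exact hXs
        have hℓexp' : exp ℓ ∈
            acl (gens (Submodule.span ℚ ({τ} : Set E) ⊔ Submodule.span ℚ (range c))) := by
          rw [← hX]; exact hℓexp
        have hℓ' : ℓ ∉ acl (gens (Submodule.span ℚ ({τ} : Set E) ⊔ Submodule.span ℚ (range c))) := by
          rw [← hX]; exact hℓ
        obtain ⟨θ, m, hm, hθexp, hθc, hθτ, hθℓ⟩ := hshift c hXs' hℓexp' hℓ'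
        have hθX : ∀ x ∈ X, θ x = x := fun x hx =>
          CaseIIReduce.apply_eq_self_of_mem_sup_span θ hθτ hθc (by rw [← hX]; exact hx)
        have hθa : θ a = a := hfix θ hθexp
        have hθH : ∀ u, u ∈ H ↔ θ u ∈ H := STAB θ hθexp hθτ hθa
        have hτX : τ ∈ X := hΛ₀X (Submodule.mem_span_singleton_self τ)
        have hXfg : X.FG := by
          rw [hX]; exact (Submodule.fg_span_singleton τ).sup (Submodule.fg_span (finite_range c))
        have hm' : (m : ℚ) ≠ 0 := Nat.cast_ne_zero.2 hm.ne'
        have haX : a ∈ X := hcore X hτX hXfg hXs ℓ hℓexp hℓ H r v hPeq.symm hv hA θ hθexp hθX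
          (m : ℚ) hm' hθℓ hθH a haH hθa
        have hδX : predim (Submodule.span ℚ ({τ} : Set E)) X = 0 := by
          have h1 := hΛ₀ hΛ₀X (hfgH.mono hXH)
          have h2 := hXs hXH hfgXH
          have hadd := predim_add hΛ₀X hXH hfgH
          linarith
        exact hne (le_antisymm hXH (MIN X hΛ₀X hXH haX hδX))
      · -- `P ≠ H`: recurse with the bigger strong A-closed space `P`
        refine ih ((X ⊔ Submodule.span ℚ {ℓ}) ⊔ Submodule.span ℚ (range v)) (N + 1 + r)
          (Fin.append (Fin.snoc c ℓ : Fin (N + 1) → E) v) ?_ hPH hPeq ?_ hPA ?_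
        · rw [CaseIIReduce.sup_span_range_append, CaseIIReduce.sup_span_range_snoc, ← hX]
        · exact (CaseIICore.isStrong_and_predim_eq_zero_of_forall_mem_acl hVs v fun i => (hv i).2).1
        · have hXP : X ≤ (X ⊔ Submodule.span ℚ {ℓ}) ⊔ Submodule.span ℚ (range v) :=
            le_sup_left.trans le_sup_left
          have hadd := ldim_add hXP hPH hfgXH
          have hpos : 0 < ldim X ((X ⊔ Submodule.span ℚ {ℓ}) ⊔ Submodule.span ℚ (range v)) :=
            (ldim_pos_iff (hfgXH.mono hPH)).2 fun hPX => hℓX (hPX hℓP)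
          omega
  /- (5) hence the A-closure of `Λ₀` in `H` is `H`: `H` is an A-extension of `Λ₀` -/
  obtain ⟨r₀, v₀, hv₀H, hv₀, hP₀A⟩ := CaseIIReduce.exists_maximal_Achain hΛ₀H hfgH
  have hP₀H : Submodule.span ℚ ({τ} : Set E) ⊔ Submodule.span ℚ (range v₀) ≤ H :=
    sup_le hΛ₀H (Submodule.span_le.2 (range_subset_iff.2 hv₀H))
  have hP₀eq : Submodule.span ℚ ({τ} : Set E) ⊔ Submodule.span ℚ (range v₀) = H := by
    by_contra hne
    exact key _ _ r₀ v₀ rfl hP₀H hne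
      (CaseIICore.isStrong_and_predim_eq_zero_of_forall_mem_acl hΛ₀ v₀ fun i => (hv₀ i).2).1
      hP₀A le_rfl
  /- (6) A-extensions of `ℚτ` lie in every `exp`-closed relatively algebraically closed
  intermediate field containing `τ` -/
  rw [IntermediateField.mem_sInf]
  rintro K ⟨hτK, hKexp, hKalg⟩
  have hΛ₀K : Submodule.span ℚ ({τ} : Set E) ≤ Subalgebra.toSubmodule K.toSubalgebra :=
    (Submodule.span_singleton_le_iff_mem _ _).2 hτK
  have hle := CaseIIReduce.sup_span_range_le_of_Achain v₀ (fun i => (hv₀ i).2) K hΛ₀K hKexp hKalg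
  have haP₀ : a ∈ Submodule.span ℚ ({τ} : Set E) ⊔ Submodule.span ℚ (range v₀) := by
    rw [hP₀eq]; exact haH
  exact hle haP₀

end Summit.Schanuel.Schanuel.Theorems.RigidCore
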